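import Literature.NumberTheory.Irrationality.PAdicZetaValues.HurwitzVolkenbornProofs
import Literature.NumberTheory.Irrationality.PAdicZetaValues.ZetaNegUnitClassesProofs
import HarnessLib

/-!
# Lai 2025, Lemma 2.7 (every prime `p`): `ζ_p(j) = (1/q_p) Σ_{a<q_p, p∤a} ω(a)^{1−j} ζ_p(j, a/q_p)` —
# PROOF of the named fact `lai2025TwoAdic_lemma27`

L. Lai, *On the irrationality of certain 2-adic zeta values*, Int. J. Number Theory 21 (2025) =
arXiv:2304.00816 [Lai2025TwoAdicZeta], §2.3, **Lemma 2.7**: "For any odd integer `j ≥ 3`, we have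
`ζ_p(j) = (1/q_p) Σ_{a=0, p∤a}^{q_p−1} ω(a)^{1−j} ζ_p(j, a/q_p)`. *Proof.* It follows directly from the
definition and the reflection formula."  The source's `ζ_p(s) := L_p(s, ω^{1−s})` with
`L_p(s, χ) := (⟨M⟩^{1−s}/M) Σ_{p∤a} χ(a) ζ_p(s, a/M)`; the TREE's `ζ_p(j)` (`PAdicZetaValues/Basic.lean`,
`padicZetaValue`) is the INTERPOLATION limit `lim_N −(1 − p^{m_N−1})B_{m_N}/m_N`,
`m_N = (p−1)p^{N+j} + 1 − j`, and `ζ_p(j, x)` is the Volkenborn form of `Hurwitz.lean`.  So the discharge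
PROVES "the branches interpolating the values of the Riemann zeta function at negative integers" for the
branch `ω^{1−j}`:

* §1 `tendsto_cast_zetaNeg_interpIndex`: for `j ≥ 2`, ANY `e`, and `W_a = lim_r S_r((a + p^{e+1}t)^{1−j})`
  (`a < p^{e+1}`, `p ∤ a`): the EXACT defining sequence of `padicZetaValue p j` converges to
  `(Σ_a W_a)/(p^{e+1}(j−1))` — from `ZetaNegUnitClassesProofs` (`p^{e+1}(1 − p^{m−1})B_m =
  Σ_a ∫(a + p^{e+1}t)^m dt`, the uniform bound along `m_N + j − 1 = (p−1)p^{N+j}`) and `m_N → 1 − j`;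
  hence `padicZetaValue_eq_sum_unitClasses`.
* §2 the unit classes `a` (`p ∤ a`): `‖a‖ = 1`, `ω(a) = teichmullerUnit p a`, `ω(a/p^{e+1}) = ω(a)/p^{e+1}`
  (valuation `−(e+1)`, unit part `a`), `⟨a/p^{e+1} + m⟩ = (a + p^{e+1}m)/ω(a)` (`angle_add_natCast` of
  `HurwitzVolkenbornProofs`), and `ω(a)^{1−j} ζ_p(j, a/p^{e+1}) = W_a/(j−1)` — `ω(a)` CANCELS
  (`teichmuller_zpow_mul_padicHurwitzZeta_unitClass`).
* §3 `q_p = p^{e+1}` (`e = 1` for `p = 2`, else `e = 0`) and the assembly `lai2025TwoAdic_lemma27_holds`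
  (no reflection formula is needed for this form of the lemma; oddness of `j` is not used).

CONVENTIONS: `B_m` = Mathlib's `bernoulli` (as in `zetaNeg` and the tree's `tendsto_volkenbornSum_pow`).
Theorems only; `Basic.lean` / `Hurwitz.lean` untouched.
Cell pub-zeta5 (HONEST FRAMING: systematic search; no irrationality claim unless kernel-certified): a
`p`-adic interpolation lemma relating the tree's two typed `ζ_p`'s; nothing here bears on `ζ(5) ∈ ℝ`.
-/

noncomputable section

open Filter Finset
open scoped Topology

namespace Literature.NumberTheory.Irrationality.PAdicZetaValues

open Literature.NumberTheory.LocalFields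

variable {p : ℕ} [hp : Fact p.Prime]

/-! ## §1. The interpolation along `m_N = (p−1)p^{N+j} + 1 − j` -/

/-- `m_N(p, j) + (j − 1) = (p − 1) p^{N+j}`. [cite: Lai2025TwoAdicZeta, §2.3 (interpolation along `k ≡ s (mod p−1)`, `k → s`)] -/
theorem interpIndex_add_pred (j N : ℕ) (hj : 1 ≤ j) :
    interpIndex p j N + (j - 1) = (p - 1) * p ^ (N + j) := by
  have h := interpIndex_add_sub_one (p := p) hp.out.two_le j N
  omega

/-- The tree's `ζ_p(1 − m)`-sequence in closed form: `((zetaNeg p m : ℚ) : ℚ_p) = −(1 − p^{m−1}) B_m / m`.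
[cite: Lai2025TwoAdicZeta, §2.3 (values at negative integers)] -/
theorem cast_zetaNeg (m : ℕ) :
    ((zetaNeg p m : ℚ) : ℚ_[p]) =
      -((1 - (p : ℚ_[p]) ^ (m - 1)) * ((bernoulli m : ℚ) : ℚ_[p])) / (m : ℚ_[p]) := by
  simp only [zetaNeg]
  push_cast
  ring

/-- `‖a‖_p = 1` for `p ∤ a`. [cite: Lai2025TwoAdicZeta, §2.3 (the unit classes `a`, `p ∤ a`)] -/
theorem norm_natCast_of_not_dvd {a : ℕ} (ha : ¬ p ∣ a) : ‖(a : ℚ_[p])‖ = 1 :=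
  Padic.norm_natCast_eq_one_iff.mpr ((Nat.Prime.coprime_iff_not_dvd hp.out).mpr ha)

/-- `‖p^{e+1}‖_p ≤ p⁻¹`. [folklore] -/
private theorem norm_natCast_pow_succ_le (e : ℕ) : ‖((p ^ (e + 1) : ℕ) : ℚ_[p])‖ ≤ (p : ℝ)⁻¹ := by
  have hp1 : (1 : ℝ) ≤ p := by exact_mod_cast hp.out.one_lt.le
  push_cast
  rw [norm_pow, Padic.norm_p, pow_succ]
  exact mul_le_of_le_one_left (by positivity) (pow_le_one₀ (by positivity) (inv_le_one_of_one_le₀ hp1))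

/-- **The interpolation property for the branch `ω^{1−j}`** (every prime `p`, `j ≥ 2`, any `e`): if for
each unit class `a < p^{e+1}`, `p ∤ a`, the Riemann sums of `(a + p^{e+1}t)^{1−j}` tend to `W_a`, then the
tree's defining sequence `N ↦ −(1 − p^{m_N−1}) B_{m_N}/m_N`, `m_N = (p−1)p^{N+j} + 1 − j`, CONVERGES in
`ℚ_p` to `(Σ_a W_a)/(p^{e+1}(j − 1))` ("`ζ_p(s) = lim_{k → s} ζ(k)` … the branches interpolating the
values of the Riemann zeta function at negative integers").
[cite: Lai2025TwoAdicZeta, §1 (p. 2) and §2.3 (p. 6)] -/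
theorem tendsto_cast_zetaNeg_interpIndex {j : ℕ} (hj2 : 2 ≤ j) (e : ℕ) {W : ℕ → ℚ_[p]}
    (hW : ∀ a ∈ (range (p ^ (e + 1))).filter (fun a => ¬ p ∣ a),
      Tendsto (volkenbornSum p (fun t : ℤ_[p] =>
        ((a : ℚ_[p]) + ((p ^ (e + 1) : ℕ) : ℚ_[p]) * (t : ℚ_[p])) ^ (-((j - 1 : ℕ) : ℤ)))) atTop
        (𝓝 (W a))) :
    Tendsto (fun N : ℕ => ((zetaNeg p (interpIndex p j N) : ℚ) : ℚ_[p])) atTop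
      (𝓝 ((∑ a ∈ (range (p ^ (e + 1))).filter (fun a => ¬ p ∣ a), W a) /
        (((p ^ (e + 1) : ℕ) : ℚ_[p]) * ((j : ℚ_[p]) - 1)))) := by
  have hp1 : (1 : ℝ) < p := by exact_mod_cast hp.out.one_lt
  set U : Finset ℕ := (range (p ^ (e + 1))).filter (fun a => ¬ p ∣ a) with hU
  set Q : ℚ_[p] := ((p ^ (e + 1) : ℕ) : ℚ_[p]) with hQ
  -- `A_N := p^{e+1}(1 − p^{m_N−1}) B_{m_N} → Σ_a W_a`
  set A : ℕ → ℚ_[p] := fun N => Q * (1 - (p : ℚ_[p]) ^ (interpIndex p j N - 1)) *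
    ((bernoulli (interpIndex p j N) : ℚ) : ℚ_[p]) with hA
  have hWsum : Tendsto (fun r => ∑ a ∈ U, volkenbornSum p (fun t : ℤ_[p] =>
      ((a : ℚ_[p]) + Q * (t : ℚ_[p])) ^ (-((j - 1 : ℕ) : ℤ))) r) atTop (𝓝 (∑ a ∈ U, W a)) :=
    tendsto_finsetSum U fun a ha => hW a ha
  have hbound : ∀ N, ‖A N - ∑ a ∈ U, W a‖ ≤ (p : ℝ) * ((p : ℝ)⁻¹) ^ (N + j) := by
    intro N
    have hm0 : interpIndex p j N ≠ 0 := by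
      have := two_le_interpIndex (p := p) hp.out.two_le j N
      omega
    have hme : interpIndex p j N + (j - 1) = (p - 1) * p ^ (N + j) := interpIndex_add_pred j N (by omega)
    have hAN := tendsto_sum_unitClasses_volkenbornSum_pow (p := p) e hm0
    have hlim := (hAN.sub hWsum).norm
    refine le_of_tendsto' hlim fun r => ?_
    rw [← Finset.sum_sub_distrib]
    refine IsUltrametricDist.norm_sum_le_of_forall_le_of_nonneg (by positivity) fun a ha => ?_
    have ha' : ¬ p ∣ a := (mem_filter.1 ha).2
    exact norm_volkenbornSum_unit_pow_sub_zpow_le (norm_natCast_of_not_dvd ha')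
      (norm_natCast_pow_succ_le e) hme r
  have hAW : Tendsto A atTop (𝓝 (∑ a ∈ U, W a)) := by
    rw [tendsto_iff_norm_sub_tendsto_zero]
    refine squeeze_zero (fun N => norm_nonneg _) hbound ?_
    have h0 : Tendsto (fun N : ℕ => (p : ℝ) * ((p : ℝ)⁻¹) ^ (N + j)) atTop (𝓝 ((p : ℝ) * 0)) :=
      ((tendsto_pow_atTop_nhds_zero_of_lt_one (by positivity) (inv_lt_one_of_one_lt₀ hp1)).comp
        (tendsto_add_atTop_nat j)).const_mul _
    rwa [mul_zero] at h0
  -- `m_N → −(j−1)` in `ℚ_p`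
  have hcast : ∀ N, ((interpIndex p j N : ℕ) : ℚ_[p]) =
      ((p - 1 : ℕ) : ℚ_[p]) * (p : ℚ_[p]) ^ (N + j) - ((j - 1 : ℕ) : ℚ_[p]) := by
    intro N
    have h := interpIndex_add_pred (p := p) j N (by omega)
    rw [eq_sub_iff_add_eq]
    exact_mod_cast h
  have hm : Tendsto (fun N : ℕ => ((interpIndex p j N : ℕ) : ℚ_[p])) atTop
      (𝓝 (((p - 1 : ℕ) : ℚ_[p]) * 0 - ((j - 1 : ℕ) : ℚ_[p]))) := by
    have h2 : Tendsto (fun N : ℕ => (p : ℚ_[p]) ^ (N + j)) atTop (𝓝 0) :=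
      (tendsto_pow_atTop_nhds_zero_of_norm_lt_one (by rw [Padic.norm_p]; exact inv_lt_one_of_one_lt₀ hp1)).comp
        (tendsto_add_atTop_nat j)
    exact ((h2.const_mul _).sub_const _).congr fun N => (hcast N).symm
  rw [mul_zero, zero_sub] at hm
  -- the sequence is `−A_N / (Q m_N)`
  have hQ0 : Q ≠ 0 := by
    rw [hQ]
    exact_mod_cast pow_ne_zero _ hp.out.ne_zero
  have hden : Q * (-((j - 1 : ℕ) : ℚ_[p])) ≠ 0 := by
    refine mul_ne_zero hQ0 (neg_ne_zero.mpr ?_)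
    exact_mod_cast (show (j - 1 : ℕ) ≠ 0 by omega)
  have hlim := (hAW.neg).div (hm.const_mul Q) hden
  have hval : -(∑ a ∈ U, W a) / (Q * -((j - 1 : ℕ) : ℚ_[p])) = (∑ a ∈ U, W a) / (Q * ((j : ℚ_[p]) - 1)) := by
    rw [Nat.cast_sub (by omega), Nat.cast_one, mul_neg, neg_div_neg_eq]
  rw [hval] at hlim
  have key : ∀ N, ((zetaNeg p (interpIndex p j N) : ℚ) : ℚ_[p]) =
      -A N / (Q * ((interpIndex p j N : ℕ) : ℚ_[p])) := by
    intro N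
    have hm0 : ((interpIndex p j N : ℕ) : ℚ_[p]) ≠ 0 := by
      exact_mod_cast (show interpIndex p j N ≠ 0 by
        have := two_le_interpIndex (p := p) hp.out.two_le j N; omega)
    rw [cast_zetaNeg]
    simp only [hA]
    field_simp
  refine hlim.congr fun N => ?_
  rw [Pi.div_apply, key]

/-- Hence **`ζ_p(j) = (Σ_a W_a)/(p^{e+1}(j−1))`** for the tree's `padicZetaValue` (a `limUnder` of a
sequence now PROVED convergent). [cite: Lai2025TwoAdicZeta, §2.3 (p. 6)] -/
theorem padicZetaValue_eq_sum_unitClasses {j : ℕ} (hj2 : 2 ≤ j) (e : ℕ) {W : ℕ → ℚ_[p]}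
    (hW : ∀ a ∈ (range (p ^ (e + 1))).filter (fun a => ¬ p ∣ a),
      Tendsto (volkenbornSum p (fun t : ℤ_[p] =>
        ((a : ℚ_[p]) + ((p ^ (e + 1) : ℕ) : ℚ_[p]) * (t : ℚ_[p])) ^ (-((j - 1 : ℕ) : ℤ)))) atTop
        (𝓝 (W a))) :
    padicZetaValue p j = (∑ a ∈ (range (p ^ (e + 1))).filter (fun a => ¬ p ∣ a), W a) /
      (((p ^ (e + 1) : ℕ) : ℚ_[p]) * ((j : ℚ_[p]) - 1)) := by
  rw [padicZetaValue_def]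
  exact (tendsto_cast_zetaNeg_interpIndex hj2 e hW).limUnder_eq

/-! ## §2. The unit classes: `ω(a)^{1−j} ζ_p(j, a/p^{e+1}) = W_a/(j−1)` -/

/-- For `p ∤ a`: `ω(a) = teichmullerUnit p a` (valuation `0`). [cite: Lai2025TwoAdicZeta, §2.3 (definition of `ω` on `ℚ_p^×`)] -/
theorem teichmuller_natCast_of_not_dvd {a : ℕ} (ha : ¬ p ∣ a) :
    teichmuller p (a : ℚ_[p]) = teichmullerUnit p (a : ℚ_[p]) := by
  have hv : ((a : ℚ_[p])).valuation = 0 := by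
    rw [Padic.valuation_natCast, padicValNat.eq_zero_of_not_dvd ha, Nat.cast_zero]
  unfold teichmuller
  rw [hv, neg_zero, zpow_zero, one_mul, mul_one]

/-- For `p ∤ a`: **`ω(a/p^{e+1}) = ω(a)/p^{e+1}`** (valuation `−(e+1)`, unit part `a`).
[cite: Lai2025TwoAdicZeta, §2.3 ("`ω(x) := p^{v_p(x)} ω(x/p^{v_p(x)})`")] -/
theorem teichmuller_natCast_div_pow {a : ℕ} (ha : ¬ p ∣ a) (e : ℕ) :
    teichmuller p ((a : ℚ_[p]) / ((p ^ (e + 1) : ℕ) : ℚ_[p])) =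
      teichmuller p (a : ℚ_[p]) / ((p ^ (e + 1) : ℕ) : ℚ_[p]) := by
  have ha0 : (a : ℚ_[p]) ≠ 0 := norm_pos_iff.mp (by rw [norm_natCast_of_not_dvd ha]; exact one_pos)
  have hQ0 : ((p ^ (e + 1) : ℕ) : ℚ_[p]) ≠ 0 := by exact_mod_cast pow_ne_zero _ hp.out.ne_zero
  have hv : ((a : ℚ_[p]) / ((p ^ (e + 1) : ℕ) : ℚ_[p])).valuation = -((e + 1 : ℕ) : ℤ) := by
    rw [div_eq_mul_inv, Padic.valuation_mul ha0 (inv_ne_zero hQ0), Padic.valuation_inv,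
      Padic.valuation_natCast, Padic.valuation_natCast, padicValNat.eq_zero_of_not_dvd ha,
      padicValNat.prime_pow]
    simp
  have hQ : ((p ^ (e + 1) : ℕ) : ℚ_[p]) = (p : ℚ_[p]) ^ (((e + 1 : ℕ) : ℤ)) := by
    rw [zpow_natCast]
    push_cast
    rfl
  rw [teichmuller_natCast_of_not_dvd ha]
  unfold teichmuller
  rw [hv, neg_neg, ← hQ, div_mul_cancel₀ _ hQ0, zpow_neg, ← hQ, inv_mul_eq_div]

/-- `q ≤ ‖a/q‖_p` (`= q`) for `q = p^{e+1}`, `p ∤ a`. [cite: Lai2025TwoAdicZeta, §2.3 (`|x|_p ≥ q_p` at `x = a/q_p`)] -/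
theorem norm_natCast_div_pow {a : ℕ} (ha : ¬ p ∣ a) (e : ℕ) :
    ‖(a : ℚ_[p]) / ((p ^ (e + 1) : ℕ) : ℚ_[p])‖ = ((p ^ (e + 1) : ℕ) : ℝ) := by
  rw [norm_div, norm_natCast_of_not_dvd ha]
  push_cast
  rw [norm_pow, Padic.norm_p, inv_pow, one_div, inv_inv]

/-- **`⟨a/p^{e+1} + m⟩ = (a + p^{e+1} m)/ω(a)`** for `p ∤ a`, `q_p = p^{e+1}`, `m ∈ ℕ`.
[cite: Lai2025TwoAdicZeta, §2.3 (definition of `⟨x⟩`; Lemma 2.7)] -/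
theorem angle_unitClass_add_natCast {e : ℕ} (hq : qp p = p ^ (e + 1)) {a : ℕ} (ha : ¬ p ∣ a) (m : ℕ) :
    angle p ((a : ℚ_[p]) / ((p ^ (e + 1) : ℕ) : ℚ_[p]) + m) =
      ((a : ℚ_[p]) + ((p ^ (e + 1) : ℕ) : ℚ_[p]) * (m : ℚ_[p])) / teichmuller p (a : ℚ_[p]) := by
  have hQ0 : ((p ^ (e + 1) : ℕ) : ℚ_[p]) ≠ 0 := by exact_mod_cast pow_ne_zero _ hp.out.ne_zero
  have hx : ((qp p : ℕ) : ℝ) ≤ ‖(a : ℚ_[p]) / ((p ^ (e + 1) : ℕ) : ℚ_[p])‖ := by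
    rw [norm_natCast_div_pow ha e, hq]
  rw [angle_add_natCast hx m, teichmuller_natCast_div_pow ha e, div_div_eq_mul_div]
  congr 1
  rw [add_mul, div_mul_cancel₀ _ hQ0, mul_comm]

/-- **`ω(a)^{1−j} ζ_p(j, a/p^{e+1}) = W_a/(j−1)`** for `p ∤ a`, `q_p = p^{e+1}`, `W_a` the limit of the
Riemann sums of `(a + p^{e+1}t)^{1−j}` — the Teichmüller factor of "`ω(a)^{1−j} ζ_p(j, a/q_p)`" cancels
against `⟨a/q_p + t⟩^{1−j} = (a + q_p t)^{1−j} ω(a)^{j−1}`. [cite: Lai2025TwoAdicZeta, Lemma 2.7 (§2.3) with Lemma 2.6] -/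
theorem teichmuller_zpow_mul_padicHurwitzZeta_unitClass {j : ℕ} (hj1 : 1 ≤ j) {e : ℕ}
    (hq : qp p = p ^ (e + 1)) {a : ℕ} (ha : ¬ p ∣ a) {Wa : ℚ_[p]}
    (hWa : Tendsto (volkenbornSum p (fun t : ℤ_[p] =>
      ((a : ℚ_[p]) + ((p ^ (e + 1) : ℕ) : ℚ_[p]) * (t : ℚ_[p])) ^ (-((j - 1 : ℕ) : ℤ)))) atTop (𝓝 Wa)) :
    teichmuller p (a : ℚ_[p]) ^ (1 - (j : ℤ)) *
        padicHurwitzZeta p j ((a : ℚ_[p]) / ((p ^ (e + 1) : ℕ) : ℚ_[p])) =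
      (1 / ((j : ℚ_[p]) - 1)) * Wa := by
  have ha0 : (a : ℚ_[p]) ≠ 0 := norm_pos_iff.mp (by rw [norm_natCast_of_not_dvd ha]; exact one_pos)
  have hω0 : teichmuller p (a : ℚ_[p]) ≠ 0 := teichmuller_ne_zero ha0
  have hωs : teichmuller p (a : ℚ_[p]) ^ (1 - (j : ℤ)) ≠ 0 := zpow_ne_zero _ hω0
  have hexp : (1 - (j : ℤ)) = -((j - 1 : ℕ) : ℤ) := by omega
  have hG : (fun r : ℕ => (p : ℚ_[p]) ^ (-(r : ℤ)) *
      ∑ m ∈ Finset.range (p ^ r), angle p ((a : ℚ_[p]) / ((p ^ (e + 1) : ℕ) : ℚ_[p]) + m) ^ (1 - (j : ℤ))) =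
      fun r : ℕ => volkenbornSum p (fun t : ℤ_[p] =>
        ((a : ℚ_[p]) + ((p ^ (e + 1) : ℕ) : ℚ_[p]) * (t : ℚ_[p])) ^ (-((j - 1 : ℕ) : ℤ))) r /
          teichmuller p (a : ℚ_[p]) ^ (1 - (j : ℤ)) := by
    funext r
    rw [volkenbornSum_def, smul_eq_mul, ← zpow_natCast, ← zpow_neg, mul_div_assoc, sum_div]
    congr 1
    refine sum_congr rfl fun m _ => ?_
    rw [angle_unitClass_add_natCast hq ha m, div_zpow, hexp, PadicInt.coe_natCast]
  have hlim : Tendsto (fun r : ℕ => (p : ℚ_[p]) ^ (-(r : ℤ)) *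
      ∑ m ∈ Finset.range (p ^ r), angle p ((a : ℚ_[p]) / ((p ^ (e + 1) : ℕ) : ℚ_[p]) + m) ^ (1 - (j : ℤ)))
      atTop (𝓝 (Wa / teichmuller p (a : ℚ_[p]) ^ (1 - (j : ℤ)))) := by
    rw [hG]
    exact hWa.div_const _
  rw [padicHurwitzZeta_def, hlim.limUnder_eq]
  calc teichmuller p (a : ℚ_[p]) ^ (1 - (j : ℤ)) *
        (1 / ((j : ℚ_[p]) - 1) * (Wa / teichmuller p (a : ℚ_[p]) ^ (1 - (j : ℤ))))
      = 1 / ((j : ℚ_[p]) - 1) *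
          (Wa / teichmuller p (a : ℚ_[p]) ^ (1 - (j : ℤ)) * teichmuller p (a : ℚ_[p]) ^ (1 - (j : ℤ))) := by
        ring
    _ = 1 / ((j : ℚ_[p]) - 1) * Wa := by rw [div_mul_cancel₀ Wa hωs]

/-! ## §3. Lemma 2.7 -/

omit hp in
/-- `q_p` is a power of `p`: `q_p = p^{e+1}` (`e = 1` for `p = 2`, `e = 0` for odd `p`).
[cite: Lai2025TwoAdicZeta, §2.3 ("We set `q_p = p` if `p` is an odd prime, and `q_2 = 4`")] -/
theorem exists_qp_eq_pow : ∃ e : ℕ, qp p = p ^ (e + 1) := by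
  by_cases h : p = 2
  · refine ⟨1, ?_⟩
    rw [qp, if_pos h, h]
    norm_num
  · exact ⟨0, by rw [qp, if_neg h, pow_one]⟩

/-- **Lai 2025, Lemma 2.7 (every prime `p`), PROVED** (discharge of `lai2025TwoAdic_lemma27`): for odd
`j ≥ 3`, `ζ_p(j) = (1/q_p) Σ_{a<q_p, p∤a} ω(a)^{1−j} ζ_p(j, a/q_p)` — with the TREE's definitions: the
interpolation limit `padicZetaValue p j` (Basic.lean) and the Volkenborn-form Hurwitz values of
Hurwitz.lean. Both sides equal `(Σ_a W_a)/(q_p(j−1))`, `W_a = ∫_{ℤ_p} (a + q_p t)^{1−j} dt` (existence: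
`tendsto_riemannSum_zpow_neg` of `HurwitzVolkenbornProofs` at `x = a/q_p`).
[cite: Lai2025TwoAdicZeta, Lemma 2.7 (§2.3)] -/
theorem lai2025TwoAdic_lemma27_holds : lai2025TwoAdic_lemma27 := by
  intro p _ j hj hj3
  obtain ⟨e, hq⟩ := exists_qp_eq_pow (p := p)
  obtain ⟨k, hk⟩ : ∃ k : ℕ, j = k + 2 := ⟨j - 2, by omega⟩
  have hQ0 : ((p ^ (e + 1) : ℕ) : ℚ_[p]) ≠ 0 := by exact_mod_cast pow_ne_zero _ (Fact.out : p.Prime).ne_zero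
  have hexp : (-((j - 1 : ℕ) : ℤ)) = -((k : ℤ) + 1) := by omega
  -- the limits `W_a`
  obtain ⟨W, hW⟩ : ∃ W : ℕ → ℚ_[p], ∀ a ∈ (range (p ^ (e + 1))).filter (fun a => ¬ p ∣ a),
      Tendsto (volkenbornSum p (fun t : ℤ_[p] =>
        ((a : ℚ_[p]) + ((p ^ (e + 1) : ℕ) : ℚ_[p]) * (t : ℚ_[p])) ^ (-((j - 1 : ℕ) : ℤ)))) atTop
        (𝓝 (W a)) := by
    refine ⟨fun a => ((p ^ (e + 1) : ℕ) : ℚ_[p]) ^ (-((k : ℤ) + 1)) *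
      ∑' n : ℕ, ((bernoulli n : ℚ) : ℚ_[p]) *
        ((((a : ℚ_[p]) / ((p ^ (e + 1) : ℕ) : ℚ_[p])) ^ (k + 1))⁻¹ * (((n + k).choose k : ℕ) : ℚ_[p]) *
          (-((a : ℚ_[p]) / ((p ^ (e + 1) : ℕ) : ℚ_[p]))⁻¹) ^ n), fun a ha => ?_⟩
    have ha' : ¬ p ∣ a := (mem_filter.1 ha).2
    have hx1 : 1 < ‖(a : ℚ_[p]) / ((p ^ (e + 1) : ℕ) : ℚ_[p])‖ := by
      rw [norm_natCast_div_pow ha' e]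
      exact_mod_cast Nat.one_lt_pow (by omega) (Fact.out : p.Prime).one_lt
    have hV := tendsto_riemannSum_zpow_neg (p := p) hx1 k
    refine (hV.const_mul (((p ^ (e + 1) : ℕ) : ℚ_[p]) ^ (-((k : ℤ) + 1)))).congr fun r => ?_
    rw [volkenbornSum_def, smul_eq_mul, ← zpow_natCast, ← zpow_neg, mul_left_comm]
    congr 1
    rw [mul_sum]
    refine sum_congr rfl fun m _ => ?_
    rw [PadicInt.coe_natCast, hexp, ← mul_zpow]
    congr 1
    rw [mul_add, mul_div_cancel₀ _ hQ0]
  rw [padicZetaValue_eq_sum_unitClasses (by omega) e hW, hq]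
  push_cast
  have hsum : ∑ a ∈ (range (p ^ (e + 1))).filter (fun a => ¬ p ∣ a),
      teichmuller p (a : ℚ_[p]) ^ (1 - (j : ℤ)) *
        padicHurwitzZeta p j ((a : ℚ_[p]) / ((p : ℚ_[p]) ^ (e + 1))) =
      ∑ a ∈ (range (p ^ (e + 1))).filter (fun a => ¬ p ∣ a), (1 / ((j : ℚ_[p]) - 1)) * W a := by
    refine sum_congr rfl fun a ha => ?_
    have h := teichmuller_zpow_mul_padicHurwitzZeta_unitClass (by omega) hq (mem_filter.1 ha).2 (hW a ha)
    push_cast at h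
    exact h
  rw [hsum, ← mul_sum]
  have hj1 : ((j : ℚ_[p]) - 1) ≠ 0 := by
    rw [hk]
    push_cast
    rw [show (k : ℚ_[p]) + 2 - 1 = ((k + 1 : ℕ) : ℚ_[p]) by push_cast; ring]
    exact_mod_cast Nat.succ_ne_zero k
  have hQ0' : (p : ℚ_[p]) ^ (e + 1) ≠ 0 := by exact_mod_cast hQ0
  field_simp

end Literature.NumberTheory.Irrationality.PAdicZetaValues
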